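import Mathlib
import Summits.ValiantsHypothesis.ValiantsHypothesis.Theorems.LiouvilleSarnakCutRankFour

/-!
# Route LiouvilleSarnak — the window method for the crux `LiouvilleCutRank` (stmt-14775)

The rung `LiouvilleCutRankFour` (`W = 4`, stmt-21039) was proved in
`Theorems/LiouvilleSarnakCutRankFour.lean` by the WINDOW METHOD with window length `5`.  This file
states the two halves of that method for an ARBITRARY window length `K`, so that every further
finite rung `W` of the open crux `LiouvilleCutRank` (stmt-ValiantsHypothesis-14775: for every `W`,
eventually every balanced cut matrix `M_π(r, c) = λ(N_π(r, c) + 1)` of the Liouville function has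
rank `≥ W` over `ℂ`) reduces to ONE finite certificate on `λ|[1, 2^K]`:

* §1 `λ(x + 1)` for `x < 128` as a bitmask (the table for `K ≤ 7`; its low `32` bits are the table
  `61924137` of the `W = 4` file).
* §2 WINDOW TRANSFER (`card_le_rank_of_window`): for a window `s, …, s + K - 1` of bit positions of
  the cut `π` with row/column word `w`, any family of row assignments `xr a` and column assignments
  `yc b` (`a, b : ι`) on the window whose sign matrix `(λ(K_w(xr a, yc b) + 1))_{a,b}` is
  nonsingular gives `|ι| ≤ rank M_π` — set the bits below the window to `1` and above it to `0`,
  so that `N + 1 = 2^s (K + 1)` and `λ(2^s x) = (-1)^s λ(x)` (complete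
  multiplicativity, tree lemma `LiouvilleSarnakAligned.liouville_two_pow_mul`).
  The `λ`-table enters as a HYPOTHESIS `hT`
  (`λ(x+1) = ±1` according to bit `x` of `T`, `x < 2^K`), so the lemma serves every `K`.
* §3 COUNTING (`exists_window_count_btwn`): if `2c + 2 ≤ K ≤ 2n` and
  `c ⌊2n/K⌋ + min(2n mod K, c) < n`, every balanced row/column word of length `2n` has a length-`K`
  window with strictly between `c` and `K - c` row letters (window counts move by `≤ 1` per shift,
  so avoiding that range keeps EVERY window at `≤ c` row letters or every window at `≤ c` column
  letters, and then that letter occurs `≤ c ⌊2n/K⌋ + min(2n mod K, c) < n` times — block count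
  `count_le_of_sparse_windows`).

With `K = 5, c = 1` this is the `W = 4` file; with `K = 7, c = 2` and an `8 × 8` certificate it
gives the rung `W = 8` (`Theorems/LiouvilleSarnakCutRankEight.lean`).  The small shared facts
of the `W = 4` file (`λ(2^j x) = (-1)^j λ(x)` = `LiouvilleSarnakAligned.liouville_two_pow_mul`,
`#p + #¬p = N`, a cut has `n` row and `n` column positions) are imported from it, not restated.

Honest framing: elementary bookkeeping for finite rungs of an OPEN crux; `LiouvilleCutRank`
(every `W`), `DigitalBilinearLiouville` and `AlgebraicSarnak` stay open, and nothing here bears on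
VP versus VNP.  No definitions.
-/

-- the directory `ValiantsHypothesis/ValiantsHypothesis` repeats the summit name (tree layout)
set_option linter.dupNamespace false

namespace Summit.ValiantsHypothesis.ValiantsHypothesis.Theorems.LiouvilleSarnakCutRankWindow

open ArithmeticFunction

open Summit.ValiantsHypothesis.ValiantsHypothesis.Theorems.LiouvilleSarnakAligned
  (liouville_two_pow_mul)
open Summit.ValiantsHypothesis.ValiantsHypothesis.Theorems.LiouvilleSarnakCutRankFour
  (count_add_count_not)

/-! ### §1 The Liouville function on `[1, 128]` -/

/-- `λ(x + 1)` for `x < 128 = 2^7`, packed as the bitmask `Σ {2^x : λ(x+1) = 1}`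
(`= 52360471011965982881651260521324798761`; its residue mod `2^32` is the table `61924137` of
the `W = 4` rung). [folklore] -/
theorem liouville_succ_eq_of_lt (x : ℕ) (hx : x < 2 ^ 7) :
    liouville (x + 1) =
      if Nat.testBit 52360471011965982881651260521324798761 x then 1 else -1 := by
  have hx' : x < 128 := by simpa using hx
  interval_cases x <;>
    simp [liouville_apply, cardFactors_apply, Nat.primeFactorsList_ofNat,
      Nat.testBit_eq_decide_div_mod_eq]

/-! ### §2 Window transfer: a nonsingular local certificate bounds the cut rank from below -/

/-- **Window transfer** (general window length `K`).  Let `π` be a cut of the `2n` bit positions,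
`s, …, s + K - 1 < 2n` a window with row/column word `w` (`w k ↔` position `s + k` is a row bit),
`T` a correct sign table of `λ` on `[1, 2^K]`, and `xr a`, `yc b` (`a, b : ι`) local row/column bit
streams whose sign matrix `(λ(K(a,b) + 1))_{a,b}` — `K(a, b) < 2^K` the number read off the
window, row bits from `xr a`, column bits from `yc b` — is nonsingular (hypothesis `hdet`, stated
through the table `T`).  Then `|ι| ≤ rank M_π`: with all bits below the window set to `1` and all
bits above it set to `0` one has `N + 1 = 2^s (K(a,b) + 1)` and `λ(2^s x) = (-1)^s λ(x)`, so the
corresponding `ι × ι` submatrix of `M_π` is `(-1)^s` times the certificate matrix, invertible over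
`ℂ`, and `rank` does not increase under taking submatrices. [folklore] -/
theorem card_le_rank_of_window {ι : Type*} [Fintype ι] [DecidableEq ι]
    (n K : ℕ) (π : Fin n ⊕ Fin n ≃ Fin (2 * n)) (s : ℕ) (hs : s + K ≤ 2 * n)
    (T : ℕ) (hT : ∀ x < 2 ^ K, liouville (x + 1) = if Nat.testBit T x then 1 else -1)
    (w : ℕ → Bool)
    (hw : ∀ j : Fin (2 * n), s ≤ (j : ℕ) → (j : ℕ) < s + K → w ((j : ℕ) - s) = (π.symm j).isLeft)
    (xr yc : ι → ℕ → Bool)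
    (hdet : Matrix.det (Matrix.of fun a b : ι =>
        if Nat.testBit T (Nat.ofBits fun k : Fin K => if w k then xr a k else yc b k)
        then (1 : ℤ) else -1) ≠ 0) :
    Fintype.card ι ≤ (Matrix.of fun r c : Fin n → Bool =>
      (((liouville (Nat.ofBits (fun j : Fin (2 * n) => Sum.elim r c (π.symm j)) + 1) : ℤ) :
        ℂ))).rank := by
  classical
  set C : Matrix ι ι ℤ := Matrix.of fun a b : ι =>
        if Nat.testBit T (Nat.ofBits fun k : Fin K => if w k then xr a k else yc b k)
        then (1 : ℤ) else -1 with hC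
  set M : Matrix (Fin n → Bool) (Fin n → Bool) ℂ := Matrix.of fun r c : Fin n → Bool =>
      (((liouville (Nat.ofBits (fun j : Fin (2 * n) => Sum.elim r c (π.symm j)) + 1) : ℤ) : ℂ))
    with hM
  -- extension of a local window stream to all positions: ones below the window, zeros above it
  let ext : (ℕ → Bool) → ℕ → Bool := fun z j =>
    if j < s then true else if j < s + K then z (j - s) else false
  let ρ : ι → (Fin n → Bool) := fun a i => ext (xr a) (π (Sum.inl i))
  let γ : ι → (Fin n → Bool) := fun b i => ext (yc b) (π (Sum.inr i))
  let z : ι → ι → ℕ → Bool := fun a b k => if w k then xr a k else yc b k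
  -- (1) the global bit vector at `(ρ a, γ b)` is the extension of the merged local stream
  have hglob : ∀ a b (j : Fin (2 * n)), Sum.elim (ρ a) (γ b) (π.symm j) = ext (z a b) j := by
    intro a b j
    rcases hj : π.symm j with i | i
    · have hji : π (Sum.inl i) = j := by rw [← hj, Equiv.apply_symm_apply]
      rw [Sum.elim_inl]
      show ext (xr a) (π (Sum.inl i)) = ext (z a b) j
      rw [hji]
      by_cases h1 : (j : ℕ) < s
      · simp [ext, h1]
      · by_cases h2 : (j : ℕ) < s + K
        · have ht : w (j - s) = true := by
            rw [hw j (not_lt.mp h1) h2, hj, Sum.isLeft_inl]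
          simp [ext, z, h1, h2, ht]
        · simp [ext, h1, h2]
    · have hji : π (Sum.inr i) = j := by rw [← hj, Equiv.apply_symm_apply]
      rw [Sum.elim_inr]
      show ext (yc b) (π (Sum.inr i)) = ext (z a b) j
      rw [hji]
      by_cases h1 : (j : ℕ) < s
      · simp [ext, h1]
      · by_cases h2 : (j : ℕ) < s + K
        · have ht : w (j - s) = false := by
            rw [hw j (not_lt.mp h1) h2, hj, Sum.isLeft_inr]
          simp [ext, z, h1, h2, ht]
        · simp [ext, h1, h2]
  -- (2) the number with extended bits: `N + 1 = 2^s (K + 1)`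
  have hext : ∀ zz : ℕ → Bool,
      Nat.ofBits (fun j : Fin (2 * n) => ext zz j) + 1 =
        2 ^ s * (Nat.ofBits (fun k : Fin K => zz k) + 1) := by
    intro zz
    have h1 : Nat.ofBits (fun j : Fin (2 * n) => ext zz j) =
        2 ^ s * Nat.ofBits (fun k : Fin K => zz k) + (2 ^ s - 1) := by
      apply Nat.eq_of_testBit_eq
      intro i
      rw [Nat.testBit_ofBits,
        Nat.testBit_two_pow_mul_add _ (Nat.sub_lt (Nat.two_pow_pos s) Nat.one_pos),
        Nat.testBit_two_pow_sub_one, Nat.testBit_ofBits]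
      simp only [ext]
      split_ifs <;> simp_all <;> omega
    rw [h1, Nat.mul_add, mul_one, Nat.add_assoc, Nat.sub_add_cancel Nat.one_le_two_pow]
  -- (3) entries of the submatrix
  have hentry : ∀ a b, M (ρ a) (γ b) = (-1 : ℂ) ^ s * ((C a b : ℤ) : ℂ) := by
    intro a b
    have hfun : (fun j : Fin (2 * n) => Sum.elim (ρ a) (γ b) (π.symm j)) =
        fun j : Fin (2 * n) => ext (z a b) j := funext (hglob a b)
    have hN : Nat.ofBits (fun j : Fin (2 * n) => Sum.elim (ρ a) (γ b) (π.symm j)) + 1 =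
        2 ^ s * (Nat.ofBits (fun k : Fin K => z a b k) + 1) := by
      rw [hfun]; exact hext (z a b)
    have hK : Nat.ofBits (fun k : Fin K => z a b k) < 2 ^ K := Nat.ofBits_lt_two_pow _
    have hCab : C a b =
        if Nat.testBit T (Nat.ofBits fun k : Fin K => z a b k) then 1 else -1 := rfl
    simp only [hM, Matrix.of_apply]
    rw [hN, liouville_two_pow_mul, hT _ hK, hCab]
    push_cast
    split_ifs <;> simp
  -- (4) the submatrix is `(-1)^s •` the certificate matrix, hence invertible of full rank
  have hsub : M.submatrix ρ γ = ((-1 : ℂ) ^ s) • C.map (fun x : ℤ => (x : ℂ)) := by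
    ext a b
    simp only [Matrix.submatrix_apply, Matrix.smul_apply, Matrix.map_apply, smul_eq_mul]
    exact hentry a b
  have hdetC : (C.map (fun x : ℤ => (x : ℂ))).det ≠ 0 := by
    rw [← Int.cast_det]
    exact_mod_cast hdet
  have hunit : IsUnit (M.submatrix ρ γ) := by
    rw [Matrix.isUnit_iff_isUnit_det, hsub, Matrix.det_smul, isUnit_iff_ne_zero]
    exact mul_ne_zero (pow_ne_zero _ (pow_ne_zero _ (by norm_num))) hdetC
  have hrank : (M.submatrix ρ γ).rank = Fintype.card ι := Matrix.rank_of_isUnit _ hunit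
  calc Fintype.card ι = (M.submatrix ρ γ).rank := hrank.symm
    _ ≤ M.rank := Matrix.rank_submatrix_le M ρ γ

/-! ### §3 Counting: sliding windows over a balanced word -/

/-- Consecutive length-`K` window counts differ by at most one (the windows share `K - 1`
positions). [folklore] -/
theorem count_window_succ_le (p : ℕ → Prop) [DecidablePred p] (s K : ℕ) :
    Nat.count (fun k => p (s + 1 + k)) K ≤ Nat.count (fun k => p (s + k)) K + 1 ∧
    Nat.count (fun k => p (s + k)) K ≤ Nat.count (fun k => p (s + 1 + k)) K + 1 := by
  have h1 := Nat.count_succ (fun k => p (s + k)) K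
  have h2 := Nat.count_succ' (fun k => p (s + k)) K
  have h3 : (fun k => p (s + (k + 1))) = fun k => p (s + 1 + k) := by
    funext k; rw [Nat.add_assoc, Nat.add_comm 1 k]
  simp only [h3] at h2
  split_ifs at h1 h2 <;> omega

/-- **Block count.** If every length-`K` window of `[0, N)` (`0 < K ≤ N`) contains at most `c`
positions `k` with `p k`, then `#{k < N : p k} ≤ c ⌊N/K⌋ + min(N mod K, c)` (peel off the last `K`
positions; the remainder of `< K` positions lies inside the first window). [folklore] -/
theorem count_le_of_sparse_windows (p : ℕ → Prop) [DecidablePred p] (K c : ℕ) (hK : 0 < K)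
    (N : ℕ) (hN : K ≤ N) (h : ∀ s, s + K ≤ N → Nat.count (fun k => p (s + k)) K ≤ c) :
    Nat.count p N ≤ c * (N / K) + min (N % K) c := by
  induction N using Nat.strong_induction_on with
  | _ N ih =>
    obtain ⟨t, rfl⟩ : ∃ t, N = t + K := ⟨N - K, by omega⟩
    rw [Nat.count_add, Nat.add_div_right _ hK, Nat.add_mod_right, Nat.mul_succ]
    have hlast := h t le_rfl
    by_cases ht : K ≤ t
    · have := ih t (by omega) ht (fun s hs => h s (by omega))
      omega
    · have h0 : Nat.count (fun k => p (0 + k)) K ≤ c := h 0 (by omega)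
      simp only [Nat.zero_add] at h0
      have hmono : Nat.count p t ≤ Nat.count p K := Nat.count_monotone p (by omega)
      have htt : Nat.count p t ≤ t := Nat.count_le p
      have hdiv : t / K = 0 := Nat.div_eq_of_lt (by omega)
      have hmod : t % K = t := Nat.mod_eq_of_lt (by omega)
      rw [hdiv, hmod]
      have hmin : Nat.count p t ≤ min t c := le_min htt (hmono.trans h0)
      omega

/-- **Counting lemma** (general window length).  Let `2c + 2 ≤ K ≤ 2n` and
`c ⌊2n/K⌋ + min(2n mod K, c) < n`.  If both `p` and `¬ p` hold at `≥ n` of the positions `< 2n`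
(a balanced word), some length-`K` window `s, …, s + K - 1 < 2n` contains strictly more than `c` and
strictly fewer than `K - c` positions `k` with `p k`: window counts move by `≤ 1`, so avoiding that
range keeps every window at `≤ c` or every window at `≥ K - c`, and then `p` resp. `¬ p` holds at
`≤ c ⌊2n/K⌋ + min(2n mod K, c) < n` positions. [folklore] -/
theorem exists_window_count_btwn (p : ℕ → Prop) [DecidablePred p] (K c n : ℕ)
    (hKc : 2 * c + 2 ≤ K) (hKn : K ≤ 2 * n) (hsmall : c * (2 * n / K) + min (2 * n % K) c < n)
    (hR : n ≤ Nat.count p (2 * n)) (hC : n ≤ Nat.count (fun k => ¬ p k) (2 * n)) :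
    ∃ s, s + K ≤ 2 * n ∧ c < Nat.count (fun k => p (s + k)) K ∧
      Nat.count (fun k => p (s + k)) K + c < K := by
  by_contra hno
  push Not at hno
  -- every window count is `≤ c` or `≥ K - c`
  have hdich : ∀ s, s + K ≤ 2 * n →
      Nat.count (fun k => p (s + k)) K ≤ c ∨ K ≤ Nat.count (fun k => p (s + k)) K + c := by
    intro s hs
    by_cases h : c < Nat.count (fun k => p (s + k)) K
    · exact Or.inr (hno s hs h)
    · exact Or.inl (not_lt.mp h)
  -- the two regimes do not mix
  have hregime : (∀ s, s + K ≤ 2 * n → Nat.count (fun k => p (s + k)) K ≤ c) ∨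
      (∀ s, s + K ≤ 2 * n → K ≤ Nat.count (fun k => p (s + k)) K + c) := by
    rcases hdich 0 (by omega) with h0 | h0
    · left
      intro s
      induction s with
      | zero => exact fun _ => h0
      | succ s ih =>
        intro hs
        have h1 := ih (by omega)
        have h2 := (count_window_succ_le p s K).1
        rcases hdich (s + 1) hs with h3 | h3 <;> omega
    · right
      intro s
      induction s with
      | zero => exact fun _ => h0
      | succ s ih =>
        intro hs
        have h1 := ih (by omega)
        have h2 := (count_window_succ_le p s K).2
        rcases hdich (s + 1) hs with h3 | h3 <;> omega
  rcases hregime with hle | hge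
  · have := count_le_of_sparse_windows p K c (by omega) (2 * n) hKn hle
    omega
  · have hle' : ∀ s, s + K ≤ 2 * n → Nat.count (fun k => ¬ p (s + k)) K ≤ c := by
      intro s hs
      have h1 := hge s hs
      have h2 := count_add_count_not (fun k => p (s + k)) K
      omega
    have := count_le_of_sparse_windows (fun k => ¬ p k) K c (by omega) (2 * n) hKn hle'
    omega

end Summit.ValiantsHypothesis.ValiantsHypothesis.Theorems.LiouvilleSarnakCutRankWindow
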